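import Summits.CriticalPhenomena.PercolationContinuityZ3.Theorems.Transplant.FKConnectivityAllQAntipodalRootForm3RealDefs
import Summits.CriticalPhenomena.PercolationContinuityZ3.Theorems.Transplant.FKConnectivityAllQAntipodalRootFormEnvAnd

/-!
# Connectivity correlation inequalities for `φ_{w,q}`, every `q > 0` — ROOT-FORM CALCULUS, file 74p: the AND facts (facts 3, 4, 5 of the
# generic word theorem) for the REAL THREE-SPECIAL environment of ANY two-terminal series–parallel edge set, in every cell

Support file (`--supports stmt-CriticalPhenomena-4575`), FK sub-lane `prim-bschramm-fk-2` (gen 32); builds on p205010 (kernel theorem,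
internal audit signed; external expert review pending).  No definitions, no named facts, no sorries; standard axioms.  Memo
FROM-fk-2-g31-DUALITY.md §6/§9 (iii), FROM-fk-2-g32-*.md; FK-Q2 §41.  This is file 61p (`FK.RootForm.realEnv_andDel/andCon/andFree_nonneg`)
for three specials: the AND integrands of the generic engine (`Gen.EDat.gandDel/gandCon/gandE1/gandE2`, file 61α) of `realEnv3 M C a b y z w`
only involve the empty and the full pattern, i.e. the antipodal form of `AND(ω_y, ω_z, ω_w)` with the root `x = ab` deleted / contracted / placed
in one replica, so each fact is ONE instance of the rootless master AND theorem `FK.andGenW_rootless_nonpos_of_isTTSP` (AND set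
`C ∪ {y,z,w}` resp. with the apex path) — on `F` itself for the deleted root, on the host transported along `some : V ↪ Option V` with the
apex path `a – ⋆ – b` contracted (contracted root) or half free (root in one replica, nested weights glued along the free apex edge by
`FK.nestedTest_mono`), exactly as in file 61p.
[cite: Grimmett2006, §1.4 eq. (1.20) (p. 15); §3.8 Thm. (3.90) (pp. 61–62)] [cite: Wagner2006, Thm. 5.8(d), §5.3]
-/

noncomputable section

namespace Summit.CriticalPhenomena.PercolationContinuityZ3.Theorems

namespace FK

namespace RootForm

open SimpleGraph Finset Literature.Probability.LatticeModels Literature.Probability.Percolation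
open scoped Classical

variable {V : Type*} [Fintype V]

section AndDel

variable {F M C : Finset (Sym2 V)} {a b : V} {y z w : Sym2 V}

/-- **Fact 3 (deleted root) for a real three-special environment**: `0 ≤ Σ_β h(β)·([Λ_∅(β) ≤ J] − [Λ_yzw(β) ≤ J])` for every monotone `h` —
the rootless master AND theorem on `F` with AND set `{y, z, w}`. [cite: Grimmett2006, §3.8 Thm. (3.90) (pp. 61–62)] [cite: Wagner2006, Thm. 5.8(d), §5.3] -/
theorem realEnv3_andDel_nonneg (hF : IsTTSP F a b) (hy : y ∈ F) (hz : z ∈ F) (hw : w ∈ F) (hyz : y ≠ z) (hyw : y ≠ w) (hzw : z ≠ w)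
    (hM : M ⊆ ((F.erase y).erase z).erase w) (hC : C ⊆ ((F.erase y).erase z).erase w) (hMC : Disjoint M C)
    {h : ↥M.powerset → ℝ} (mh : Monotone h) (J : ℤ) :
    0 ≤ ∑ β, h β * (realEnv3 M C a b y z w β).gandDel J := by
  have hMF : M ⊆ F := hM.trans (((Finset.erase_subset _ _).trans (Finset.erase_subset _ _)).trans (Finset.erase_subset _ _))
  have hCF : C ⊆ F := hC.trans (((Finset.erase_subset _ _).trans (Finset.erase_subset _ _)).trans (Finset.erase_subset _ _))
  have hwM : w ∉ M := fun h => (Finset.mem_erase.1 (hM h)).1 rfl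
  have hzM : z ∉ M := fun h => (Finset.mem_erase.1 (Finset.mem_of_mem_erase (hM h))).1 rfl
  have hyM : y ∉ M := fun h => (Finset.mem_erase.1 (Finset.mem_of_mem_erase (Finset.mem_of_mem_erase (hM h)))).1 rfl
  have hzM1 : z ∉ insert w M := by rw [Finset.mem_insert, not_or]; exact ⟨hzw, hzM⟩
  have hyM2 : y ∉ insert z (insert w M) := by rw [Finset.mem_insert, not_or, Finset.mem_insert, not_or]; exact ⟨hyz, hyw, hyM⟩
  have hA : insert y (insert z (insert w C)) ⊆ insert s(a, b) F :=
    (Finset.insert_subset hy (Finset.insert_subset hz (Finset.insert_subset hw hCF))).trans (Finset.subset_insert _ _)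
  have hNA : Disjoint M (insert y (insert z (insert w C))) :=
    Finset.disjoint_insert_right.2 ⟨hyM, Finset.disjoint_insert_right.2 ⟨hzM, Finset.disjoint_insert_right.2 ⟨hwM, hMC⟩⟩⟩
  have key := andGenW_rootless_nonpos_of_isTTSP hF hMF hA
    (((Finset.subset_insert _ _).trans (Finset.subset_insert _ _)).trans (Finset.subset_insert _ _)) hNA
    (w := fun n : ℕ => if (n : ℤ) + 0 ≤ J then (1 : ℝ) else 0) (levelWeight_antitone 0 J) (extWeight_mono mh)
  rw [← Finset.sum_coe_sort] at key
  have hneg : ∑ β : ↥M.powerset, h β * (realEnv3 M C a b y z w β).gandDel J =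
      -∑ i : ↥M.powerset, ((fun n : ℕ => if (n : ℤ) + 0 ≤ J then (1 : ℝ) else 0)
          (clusterCount (↑(i.1 ∪ insert y (insert z (insert w C))) : BondConfig V) ∅ +
            clusterCount (↑(M \ i.1 ∪ C) : BondConfig V) ∅) -
        (fun n : ℕ => if (n : ℤ) + 0 ≤ J then (1 : ℝ) else 0)
          (clusterCount (↑(M \ i.1 ∪ insert y (insert z (insert w C))) : BondConfig V) ∅ +
            clusterCount (↑(i.1 ∪ C) : BondConfig V) ∅)) *
        h ⟨i.1 ∩ M, Finset.mem_powerset.2 Finset.inter_subset_right⟩ := by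
    rw [← Finset.sum_neg_distrib]
    refine Finset.sum_congr rfl fun β _ => ?_
    rw [extWeight_apply h β]
    have hX : β.1 ⊆ M := Finset.mem_powerset.1 β.2
    have hyX : y ∉ β.1 := fun h => hyM (hX h)
    have hzX : z ∉ β.1 := fun h => hzM (hX h)
    have hwX : w ∉ β.1 := fun h => hwM (hX h)
    obtain ⟨t0, -, -, -, -, -, -, tu⟩ := patSet3_table y z w β.1
    simp only [Gen.EDat.gandDel, realEnv3_d, t0, tu]
    simp only [realPDat, PDat.adel, ind, apExpC, add_zero, Finset.insert_sdiff_insert,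
      Finset.sdiff_insert_of_notMem hyM2, Finset.sdiff_insert_of_notMem hzM1, Finset.sdiff_insert_of_notMem hwM,
      Finset.insert_sdiff_of_notMem _ hyX, Finset.insert_sdiff_of_notMem _ hzX, Finset.insert_sdiff_of_notMem _ hwX,
      Finset.insert_union, Finset.union_insert, Nat.cast_add]
    rw [add_comm (clusterCount (↑(insert y (insert z (insert w (M \ β.1 ∪ C)))) : BondConfig V) ∅ : ℤ)]
    ring
  rw [hneg]
  linarith

end AndDel

section AndApex

variable {F M C : Finset (Sym2 V)} {a b : V} {y z w : Sym2 V} {U : Type*} [Fintype U] {j : V ↪ U} {r : U}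

omit [Fintype V] [Fintype U] in
/-- image of a union with three specials inserted. [folklore] -/
theorem map_insert₃_union (y z w : Sym2 V) (X C : Finset (Sym2 V)) :
    (insert y (insert z (insert w X)) ∪ C).map j.sym2Map =
      insert (j.sym2Map y) (insert (j.sym2Map z) (insert (j.sym2Map w) (X.map j.sym2Map ∪ C.map j.sym2Map))) := by
  rw [Finset.map_union, Finset.map_insert, Finset.map_insert, Finset.map_insert, Finset.insert_union, Finset.insert_union,
    Finset.insert_union]

/-- **Fact 4 (contracted root) for a real three-special environment, along an embedding with a fresh apex.**
[cite: Grimmett2006, §3.8 Thm. (3.90) (pp. 61–62)] [cite: Wagner2006, Thm. 5.8(d), §5.3] -/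
theorem realEnv3_andCon_apex (hr : r ∉ Set.range j) (hF : IsTTSP F a b) (hy : y ∈ F) (hz : z ∈ F) (hw : w ∈ F)
    (hyz : y ≠ z) (hyw : y ≠ w) (hzw : z ≠ w)
    (hM : M ⊆ ((F.erase y).erase z).erase w) (hC : C ⊆ ((F.erase y).erase z).erase w) (hMC : Disjoint M C)
    {h : ↥M.powerset → ℝ} (mh : Monotone h) (J : ℤ) :
    0 ≤ ∑ β, h β * (realEnv3 M C a b y z w β).gandCon J := by
  have hMF : M ⊆ F := hM.trans (((Finset.erase_subset _ _).trans (Finset.erase_subset _ _)).trans (Finset.erase_subset _ _))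
  have hCF : C ⊆ F := hC.trans (((Finset.erase_subset _ _).trans (Finset.erase_subset _ _)).trans (Finset.erase_subset _ _))
  have hwM : w ∉ M := fun h => (Finset.mem_erase.1 (hM h)).1 rfl
  have hzM : z ∉ M := fun h => (Finset.mem_erase.1 (Finset.mem_of_mem_erase (hM h))).1 rfl
  have hyM : y ∉ M := fun h => (Finset.mem_erase.1 (Finset.mem_of_mem_erase (Finset.mem_of_mem_erase (hM h)))).1 rfl
  have hzM1 : z ∉ insert w M := by rw [Finset.mem_insert, not_or]; exact ⟨hzw, hzM⟩
  have hyM2 : y ∉ insert z (insert w M) := by rw [Finset.mem_insert, not_or, Finset.mem_insert, not_or]; exact ⟨hyz, hyw, hyM⟩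
  obtain ⟨N0, hN0⟩ : ∃ N0, Nat.card {x : U // x ∉ Set.range j} = N0 := ⟨_, rfl⟩
  have hE := isTTSP_map_apex hF hr
  -- the sets of the rootless AND theorem on the apex host
  have hNF : M.map j.sym2Map ⊆ F.map j.sym2Map ∪ ({s(j a, r)} ∪ {s(r, j b)}) :=
    (Finset.map_subset_map.2 hMF).trans Finset.subset_union_left
  have hCU : C.map j.sym2Map ∪ ({s(j a, r)} ∪ {s(r, j b)}) ⊆ F.map j.sym2Map ∪ ({s(j a, r)} ∪ {s(r, j b)}) :=
    Finset.union_subset_union (Finset.map_subset_map.2 hCF) le_rfl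
  have hA : insert (j.sym2Map y) (insert (j.sym2Map z) (insert (j.sym2Map w) (C.map j.sym2Map ∪ ({s(j a, r)} ∪ {s(r, j b)})))) ⊆
      insert s(j a, j b) (F.map j.sym2Map ∪ ({s(j a, r)} ∪ {s(r, j b)})) :=
    (Finset.insert_subset (Finset.mem_union_left _ ((Finset.mem_map' _).2 hy))
      (Finset.insert_subset (Finset.mem_union_left _ ((Finset.mem_map' _).2 hz))
        (Finset.insert_subset (Finset.mem_union_left _ ((Finset.mem_map' _).2 hw)) hCU))).trans (Finset.subset_insert _ _)
  have hNA : Disjoint (M.map j.sym2Map)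
      (insert (j.sym2Map y) (insert (j.sym2Map z) (insert (j.sym2Map w) (C.map j.sym2Map ∪ ({s(j a, r)} ∪ {s(r, j b)}))))) := by
    rw [Finset.disjoint_insert_right, Finset.disjoint_insert_right, Finset.disjoint_insert_right, Finset.disjoint_union_right,
      Finset.disjoint_union_right, Finset.disjoint_singleton_right, Finset.disjoint_singleton_right, Finset.mem_map', Finset.mem_map',
      Finset.mem_map']
    exact ⟨hyM, hzM, hwM, (Finset.disjoint_map _).2 hMC, fun h => apex_notMem_of_mem_map hr M _ h (Sym2.mem_mk_right _ _),
      fun h => apex_notMem_of_mem_map hr M _ h (Sym2.mem_mk_left _ _)⟩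
  have key := andGenW_rootless_nonpos_of_isTTSP hE hNF hA
    (((Finset.subset_insert _ _).trans (Finset.subset_insert _ _)).trans (Finset.subset_insert _ _)) hNA
    (w := fun n : ℕ => if (n : ℤ) + (4 - 2 * (N0 : ℤ)) ≤ J then (1 : ℝ) else 0) (levelWeight_antitone _ J)
    (h := fun X' => h ⟨(Finset.univ.filter fun e : Sym2 V => j.sym2Map e ∈ X') ∩ M, Finset.mem_powerset.2 Finset.inter_subset_right⟩)
    (fun X' Y' hXY _ => pullWeight_mono mh hXY)
  rw [← sum_powerset_map, ← Finset.sum_coe_sort] at key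
  have hneg : ∑ β : ↥M.powerset, h β * (realEnv3 M C a b y z w β).gandCon J =
      -∑ i : ↥M.powerset, ((fun n : ℕ => if (n : ℤ) + (4 - 2 * (N0 : ℤ)) ≤ J then (1 : ℝ) else 0)
          (clusterCount (↑(i.1.map j.sym2Map ∪ insert (j.sym2Map y) (insert (j.sym2Map z) (insert (j.sym2Map w)
              (C.map j.sym2Map ∪ ({s(j a, r)} ∪ {s(r, j b)}))))) : BondConfig U) ∅ +
            clusterCount (↑(M.map j.sym2Map \ i.1.map j.sym2Map ∪ (C.map j.sym2Map ∪ ({s(j a, r)} ∪ {s(r, j b)}))) : BondConfig U) ∅) -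
        (fun n : ℕ => if (n : ℤ) + (4 - 2 * (N0 : ℤ)) ≤ J then (1 : ℝ) else 0)
          (clusterCount (↑(M.map j.sym2Map \ i.1.map j.sym2Map ∪ insert (j.sym2Map y) (insert (j.sym2Map z) (insert (j.sym2Map w)
              (C.map j.sym2Map ∪ ({s(j a, r)} ∪ {s(r, j b)}))))) : BondConfig U) ∅ +
            clusterCount (↑(i.1.map j.sym2Map ∪ (C.map j.sym2Map ∪ ({s(j a, r)} ∪ {s(r, j b)}))) : BondConfig U) ∅)) *
        h ⟨(Finset.univ.filter fun e : Sym2 V => j.sym2Map e ∈ i.1.map j.sym2Map) ∩ M, Finset.mem_powerset.2 Finset.inter_subset_right⟩ := by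
    rw [← Finset.sum_neg_distrib]
    refine Finset.sum_congr rfl fun β _ => ?_
    rw [pullWeight_map h β]
    have hX : β.1 ⊆ M := Finset.mem_powerset.1 β.2
    have hyX : y ∉ β.1 := fun h => hyM (hX h)
    have hzX : z ∉ β.1 := fun h => hzM (hX h)
    have hwX : w ∉ β.1 := fun h => hwM (hX h)
    -- the four replica sets of the apex host, as images
    have e1 : β.1.map j.sym2Map ∪ insert (j.sym2Map y) (insert (j.sym2Map z) (insert (j.sym2Map w)
          (C.map j.sym2Map ∪ ({s(j a, r)} ∪ {s(r, j b)})))) =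
        insert s(r, j b) (insert s(j a, r) ((insert y (insert z (insert w β.1)) ∪ C).map j.sym2Map)) := by
      rw [map_insert₃_union]; simp only [Finset.insert_eq]; ac_rfl
    have e2 : M.map j.sym2Map \ β.1.map j.sym2Map ∪ (C.map j.sym2Map ∪ ({s(j a, r)} ∪ {s(r, j b)})) =
        insert s(r, j b) (insert s(j a, r) ((insert y (insert z (insert w M)) \ insert y (insert z (insert w β.1)) ∪ C).map j.sym2Map)) := by
      rw [Finset.insert_sdiff_insert, Finset.sdiff_insert_of_notMem hyM2, Finset.insert_sdiff_insert, Finset.sdiff_insert_of_notMem hzM1,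
        Finset.insert_sdiff_insert, Finset.sdiff_insert_of_notMem hwM, Finset.map_union, ← map_sdiff_sym2Map]
      simp only [Finset.insert_eq]; ac_rfl
    have e3 : M.map j.sym2Map \ β.1.map j.sym2Map ∪ insert (j.sym2Map y) (insert (j.sym2Map z) (insert (j.sym2Map w)
          (C.map j.sym2Map ∪ ({s(j a, r)} ∪ {s(r, j b)})))) =
        insert s(r, j b) (insert s(j a, r) ((insert y (insert z (insert w M)) \ β.1 ∪ C).map j.sym2Map)) := by
      rw [Finset.insert_sdiff_of_notMem _ hyX, Finset.insert_sdiff_of_notMem _ hzX, Finset.insert_sdiff_of_notMem _ hwX, map_insert₃_union,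
        ← map_sdiff_sym2Map]
      simp only [Finset.insert_eq]; ac_rfl
    have e4 : β.1.map j.sym2Map ∪ (C.map j.sym2Map ∪ ({s(j a, r)} ∪ {s(r, j b)})) =
        insert s(r, j b) (insert s(j a, r) ((β.1 ∪ C).map j.sym2Map)) := by
      rw [Finset.map_union]; simp only [Finset.insert_eq]; ac_rfl
    have k1 := clusterCount_insert_apex₂ hr (insert y (insert z (insert w β.1)) ∪ C) a b
    have k2 := clusterCount_insert_apex₂ hr (insert y (insert z (insert w M)) \ insert y (insert z (insert w β.1)) ∪ C) a b
    have k3 := clusterCount_insert_apex₂ hr (insert y (insert z (insert w M)) \ β.1 ∪ C) a b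
    have k4 := clusterCount_insert_apex₂ hr (β.1 ∪ C) a b
    rw [clusterCount_map_eq, hN0] at k1 k2 k3 k4
    rw [e1, e2, e3, e4]
    simp only [apexCon_le_iff k1 k2, apexCon_le_iff k3 k4]
    obtain ⟨t0, -, -, -, -, -, -, tu⟩ := patSet3_table y z w β.1
    simp only [Gen.EDat.gandCon, realEnv3_d, t0, tu]
    simp only [realPDat, PDat.acon, ind, bit, reachB, apExpC, decide_eq_true_eq]
    rw [Nat.add_comm (clusterCount (↑(insert y (insert z (insert w M)) \ β.1 ∪ C) : BondConfig V) ∅)]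
    ring
  rw [hneg]
  linarith

/-- **Fact 5 (free root, nested) for a real three-special environment, along an embedding with a fresh apex.**
`0 ≤ Σ_β (h₁(β)·([Λ_∅+K¹_∅ ≤ J] − [Λ_yzw+K¹_yzw ≤ J]) + h₀(β)·([Λ_∅+K²_∅ ≤ J] − [Λ_yzw+K²_yzw ≤ J]))` for monotone `h₀ ≤ h₁`.
[cite: Grimmett2006, §3.8 Thm. (3.90) (pp. 61–62)] [cite: Wagner2006, Thm. 5.8(d), §5.3] -/
theorem realEnv3_andFree_apex (hr : r ∉ Set.range j) (hF : IsTTSP F a b) (hy : y ∈ F) (hz : z ∈ F) (hw : w ∈ F)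
    (hyz : y ≠ z) (hyw : y ≠ w) (hzw : z ≠ w)
    (hM : M ⊆ ((F.erase y).erase z).erase w) (hC : C ⊆ ((F.erase y).erase z).erase w) (hMC : Disjoint M C)
    {h0 h1 : ↥M.powerset → ℝ} (m0 : Monotone h0) (m1 : Monotone h1) (le : ∀ β, h0 β ≤ h1 β) (J : ℤ) :
    0 ≤ ∑ β, (h1 β * (realEnv3 M C a b y z w β).gandE1 J + h0 β * (realEnv3 M C a b y z w β).gandE2 J) := by
  have hMF : M ⊆ F := hM.trans (((Finset.erase_subset _ _).trans (Finset.erase_subset _ _)).trans (Finset.erase_subset _ _))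
  have hCF : C ⊆ F := hC.trans (((Finset.erase_subset _ _).trans (Finset.erase_subset _ _)).trans (Finset.erase_subset _ _))
  have hwM : w ∉ M := fun h => (Finset.mem_erase.1 (hM h)).1 rfl
  have hzM : z ∉ M := fun h => (Finset.mem_erase.1 (Finset.mem_of_mem_erase (hM h))).1 rfl
  have hyM : y ∉ M := fun h => (Finset.mem_erase.1 (Finset.mem_of_mem_erase (Finset.mem_of_mem_erase (hM h)))).1 rfl
  have hzM1 : z ∉ insert w M := by rw [Finset.mem_insert, not_or]; exact ⟨hzw, hzM⟩
  have hyM2 : y ∉ insert z (insert w M) := by rw [Finset.mem_insert, not_or, Finset.mem_insert, not_or]; exact ⟨hyz, hyw, hyM⟩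
  obtain ⟨N0, hN0⟩ : ∃ N0, Nat.card {x : U // x ∉ Set.range j} = N0 := ⟨_, rfl⟩
  have hE := isTTSP_map_apex hF hr
  have heM : s(j a, r) ∉ M.map j.sym2Map := fun h => apex_notMem_of_mem_map hr M _ h (Sym2.mem_mk_right _ _)
  have heF : s(j a, r) ∈ F.map j.sym2Map ∪ ({s(j a, r)} ∪ {s(r, j b)}) :=
    Finset.mem_union_right _ (Finset.mem_union_left _ (Finset.mem_singleton_self _))
  have hfF : s(r, j b) ∈ F.map j.sym2Map ∪ ({s(j a, r)} ∪ {s(r, j b)}) :=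
    Finset.mem_union_right _ (Finset.mem_union_right _ (Finset.mem_singleton_self _))
  have hNF : insert s(j a, r) (M.map j.sym2Map) ⊆ F.map j.sym2Map ∪ ({s(j a, r)} ∪ {s(r, j b)}) :=
    Finset.insert_subset heF ((Finset.map_subset_map.2 hMF).trans Finset.subset_union_left)
  have hCU : C.map j.sym2Map ∪ {s(r, j b)} ⊆ F.map j.sym2Map ∪ ({s(j a, r)} ∪ {s(r, j b)}) :=
    Finset.union_subset ((Finset.map_subset_map.2 hCF).trans Finset.subset_union_left) (Finset.singleton_subset_iff.2 hfF)
  have hA : insert (j.sym2Map y) (insert (j.sym2Map z) (insert (j.sym2Map w) (C.map j.sym2Map ∪ {s(r, j b)}))) ⊆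
      insert s(j a, j b) (F.map j.sym2Map ∪ ({s(j a, r)} ∪ {s(r, j b)})) :=
    (Finset.insert_subset (Finset.mem_union_left _ ((Finset.mem_map' _).2 hy))
      (Finset.insert_subset (Finset.mem_union_left _ ((Finset.mem_map' _).2 hz))
        (Finset.insert_subset (Finset.mem_union_left _ ((Finset.mem_map' _).2 hw)) hCU))).trans (Finset.subset_insert _ _)
  have hspec : ∀ {e : Sym2 V}, s(j a, r) ≠ j.sym2Map e := fun {e} h =>
    apex_notMem_of_mem_map hr {e} _ (by rw [Finset.map_singleton]; exact Finset.mem_singleton.2 h) (Sym2.mem_mk_right _ _)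
  have hNA : Disjoint (insert s(j a, r) (M.map j.sym2Map))
      (insert (j.sym2Map y) (insert (j.sym2Map z) (insert (j.sym2Map w) (C.map j.sym2Map ∪ {s(r, j b)})))) := by
    rw [Finset.disjoint_insert_left, Finset.disjoint_insert_right, Finset.disjoint_insert_right, Finset.disjoint_insert_right,
      Finset.disjoint_union_right, Finset.disjoint_singleton_right, Finset.mem_map', Finset.mem_map', Finset.mem_map', Finset.mem_insert,
      Finset.mem_insert, Finset.mem_insert, Finset.mem_union, Finset.mem_singleton]
    refine ⟨?_, hyM, hzM, hwM, (Finset.disjoint_map _).2 hMC, fun h => apex_notMem_of_mem_map hr M _ h (Sym2.mem_mk_left _ _)⟩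
    rintro (h | h | h | h | h)
    · exact hspec h
    · exact hspec h
    · exact hspec h
    · exact apex_notMem_of_mem_map hr C _ h (Sym2.mem_mk_right _ _)
    · have hcr : j a ≠ r := fun h' => hr ⟨a, h'⟩
      rw [Sym2.eq_iff] at h
      rcases h with ⟨h', _⟩ | ⟨h', _⟩
      · exact hcr h'
      · exact hF.ne (j.injective h')
  have key := andGenW_rootless_nonpos_of_isTTSP hE hNF hA
    (((Finset.subset_insert _ _).trans (Finset.subset_insert _ _)).trans (Finset.subset_insert _ _)) hNA
    (w := fun n : ℕ => if (n : ℤ) + (3 - 2 * (N0 : ℤ)) ≤ J then (1 : ℝ) else 0) (levelWeight_antitone _ J)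
    (h := fun X' => if s(j a, r) ∈ X' then
        h1 ⟨(Finset.univ.filter fun e : Sym2 V => j.sym2Map e ∈ X'.erase s(j a, r)) ∩ M, Finset.mem_powerset.2 Finset.inter_subset_right⟩
      else h0 ⟨(Finset.univ.filter fun e : Sym2 V => j.sym2Map e ∈ X') ∩ M, Finset.mem_powerset.2 Finset.inter_subset_right⟩)
    (nestedTest_mono s(j a, r)
      (h₀ := fun X' => h0 ⟨(Finset.univ.filter fun e : Sym2 V => j.sym2Map e ∈ X') ∩ M, Finset.mem_powerset.2 Finset.inter_subset_right⟩)
      (h₁ := fun X' => h1 ⟨(Finset.univ.filter fun e : Sym2 V => j.sym2Map e ∈ X') ∩ M, Finset.mem_powerset.2 Finset.inter_subset_right⟩)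
      (fun A _ => le _) (fun X' Y' hXY _ => pullWeight_mono m0 hXY) (fun X' Y' hXY _ => pullWeight_mono m1 hXY))
  rw [Finset.sum_powerset_insert heM, ← Finset.sum_add_distrib, ← sum_powerset_map, ← Finset.sum_coe_sort] at key
  rw [← sub_nonneg, zero_sub, ← Finset.sum_neg_distrib] at key
  refine key.trans_eq (Finset.sum_congr rfl fun β _ => ?_)
  have hX : β.1 ⊆ M := Finset.mem_powerset.1 β.2
  have hyX : y ∉ β.1 := fun h => hyM (hX h)
  have hzX : z ∉ β.1 := fun h => hzM (hX h)
  have hwX : w ∉ β.1 := fun h => hwM (hX h)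
  have n0 : s(j a, r) ∉ β.1.map j.sym2Map := fun h => apex_notMem_of_mem_map hr β.1 _ h (Sym2.mem_mk_right _ _)
  rw [if_neg n0, if_pos (Finset.mem_insert_self _ _), Finset.erase_insert n0, pullWeight_map h0 β, pullWeight_map h1 β]
  -- the eight replica sets of the apex host, as images
  have s1 : β.1.map j.sym2Map ∪ insert (j.sym2Map y) (insert (j.sym2Map z) (insert (j.sym2Map w) (C.map j.sym2Map ∪ {s(r, j b)}))) =
      insert s(j b, r) ((insert y (insert z (insert w β.1)) ∪ C).map j.sym2Map) := by
    rw [map_insert₃_union, show s(r, j b) = s(j b, r) from Sym2.eq_swap]; simp only [Finset.insert_eq]; ac_rfl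
  have s2 : insert s(j a, r) (M.map j.sym2Map) \ β.1.map j.sym2Map ∪ (C.map j.sym2Map ∪ {s(r, j b)}) =
      insert s(r, j b) (insert s(j a, r) ((insert y (insert z (insert w M)) \ insert y (insert z (insert w β.1)) ∪ C).map j.sym2Map)) := by
    rw [Finset.insert_sdiff_of_notMem _ n0, Finset.insert_sdiff_insert, Finset.sdiff_insert_of_notMem hyM2, Finset.insert_sdiff_insert,
      Finset.sdiff_insert_of_notMem hzM1, Finset.insert_sdiff_insert, Finset.sdiff_insert_of_notMem hwM, Finset.map_union, ← map_sdiff_sym2Map]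
    simp only [Finset.insert_eq]; ac_rfl
  have s3 : insert s(j a, r) (M.map j.sym2Map) \ β.1.map j.sym2Map ∪ insert (j.sym2Map y) (insert (j.sym2Map z) (insert (j.sym2Map w)
        (C.map j.sym2Map ∪ {s(r, j b)}))) =
      insert s(r, j b) (insert s(j a, r) ((insert y (insert z (insert w M)) \ β.1 ∪ C).map j.sym2Map)) := by
    rw [Finset.insert_sdiff_of_notMem _ n0, Finset.insert_sdiff_of_notMem _ hyX, Finset.insert_sdiff_of_notMem _ hzX,
      Finset.insert_sdiff_of_notMem _ hwX, map_insert₃_union, ← map_sdiff_sym2Map]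
    simp only [Finset.insert_eq]; ac_rfl
  have s4 : β.1.map j.sym2Map ∪ (C.map j.sym2Map ∪ {s(r, j b)}) = insert s(j b, r) ((β.1 ∪ C).map j.sym2Map) := by
    rw [Finset.map_union, show s(r, j b) = s(j b, r) from Sym2.eq_swap]; simp only [Finset.insert_eq]; ac_rfl
  have s5 : insert s(j a, r) (β.1.map j.sym2Map) ∪ insert (j.sym2Map y) (insert (j.sym2Map z) (insert (j.sym2Map w)
        (C.map j.sym2Map ∪ {s(r, j b)}))) =
      insert s(r, j b) (insert s(j a, r) ((insert y (insert z (insert w β.1)) ∪ C).map j.sym2Map)) := by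
    rw [map_insert₃_union]; simp only [Finset.insert_eq]; ac_rfl
  have s6 : insert s(j a, r) (M.map j.sym2Map) \ insert s(j a, r) (β.1.map j.sym2Map) ∪ (C.map j.sym2Map ∪ {s(r, j b)}) =
      insert s(j b, r) ((insert y (insert z (insert w M)) \ insert y (insert z (insert w β.1)) ∪ C).map j.sym2Map) := by
    rw [Finset.insert_sdiff_insert, Finset.sdiff_insert_of_notMem heM, Finset.insert_sdiff_insert, Finset.sdiff_insert_of_notMem hyM2,
      Finset.insert_sdiff_insert, Finset.sdiff_insert_of_notMem hzM1, Finset.insert_sdiff_insert, Finset.sdiff_insert_of_notMem hwM,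
      Finset.map_union, ← map_sdiff_sym2Map, show s(r, j b) = s(j b, r) from Sym2.eq_swap]
    simp only [Finset.insert_eq]; ac_rfl
  have s7 : insert s(j a, r) (M.map j.sym2Map) \ insert s(j a, r) (β.1.map j.sym2Map) ∪ insert (j.sym2Map y) (insert (j.sym2Map z)
        (insert (j.sym2Map w) (C.map j.sym2Map ∪ {s(r, j b)}))) =
      insert s(j b, r) ((insert y (insert z (insert w M)) \ β.1 ∪ C).map j.sym2Map) := by
    rw [Finset.insert_sdiff_insert, Finset.sdiff_insert_of_notMem heM, Finset.insert_sdiff_of_notMem _ hyX,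
      Finset.insert_sdiff_of_notMem _ hzX, Finset.insert_sdiff_of_notMem _ hwX, map_insert₃_union, ← map_sdiff_sym2Map,
      show s(r, j b) = s(j b, r) from Sym2.eq_swap]
    simp only [Finset.insert_eq]; ac_rfl
  have s8 : insert s(j a, r) (β.1.map j.sym2Map) ∪ (C.map j.sym2Map ∪ {s(r, j b)}) =
      insert s(r, j b) (insert s(j a, r) ((β.1 ∪ C).map j.sym2Map)) := by
    rw [Finset.map_union]; simp only [Finset.insert_eq]; ac_rfl
  have k1 := clusterCount_insert_apex₁ hr (insert y (insert z (insert w β.1)) ∪ C) b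
  have k2 := clusterCount_insert_apex₂ hr (insert y (insert z (insert w M)) \ insert y (insert z (insert w β.1)) ∪ C) a b
  have k3 := clusterCount_insert_apex₂ hr (insert y (insert z (insert w M)) \ β.1 ∪ C) a b
  have k4 := clusterCount_insert_apex₁ hr (β.1 ∪ C) b
  have k5 := clusterCount_insert_apex₂ hr (insert y (insert z (insert w β.1)) ∪ C) a b
  have k6 := clusterCount_insert_apex₁ hr (insert y (insert z (insert w M)) \ insert y (insert z (insert w β.1)) ∪ C) b
  have k7 := clusterCount_insert_apex₁ hr (insert y (insert z (insert w M)) \ β.1 ∪ C) b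
  have k8 := clusterCount_insert_apex₂ hr (β.1 ∪ C) a b
  rw [clusterCount_map_eq, hN0] at k1 k2 k3 k4 k5 k6 k7 k8
  rw [s1, s2, s3, s4, s5, s6, s7, s8]
  simp only [apexFree_le_iff₁ k1 k2, apexFree_le_iff₂ k3 k4, apexFree_le_iff₃ k5 k6, apexFree_le_iff₄ k7 k8]
  obtain ⟨t0, -, -, -, -, -, -, tu⟩ := patSet3_table y z w β.1
  simp only [Gen.EDat.gandE1, Gen.EDat.gandE2, realEnv3_d, t0, tu]
  simp only [realPDat, PDat.a1, PDat.a2, ind, bit, reachB, apExpC, decide_eq_true_eq]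
  ring

end AndApex

section AndFinal

variable {F M C : Finset (Sym2 V)} {a b : V} {y z w : Sym2 V}

/-- **Fact 4 (contracted root) for a real three-special environment.** [cite: Grimmett2006, §3.8 Thm. (3.90) (pp. 61–62)] [cite: Wagner2006, Thm. 5.8(d), §5.3] -/
theorem realEnv3_andCon_nonneg (hF : IsTTSP F a b) (hy : y ∈ F) (hz : z ∈ F) (hw : w ∈ F) (hyz : y ≠ z) (hyw : y ≠ w) (hzw : z ≠ w)
    (hM : M ⊆ ((F.erase y).erase z).erase w) (hC : C ⊆ ((F.erase y).erase z).erase w) (hMC : Disjoint M C)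
    {h : ↥M.powerset → ℝ} (mh : Monotone h) (J : ℤ) :
    0 ≤ ∑ β, h β * (realEnv3 M C a b y z w β).gandCon J :=
  realEnv3_andCon_apex none_notMem_range_some hF hy hz hw hyz hyw hzw hM hC hMC mh J

/-- **Fact 5 (free root, nested) for a real three-special environment.** [cite: Grimmett2006, §3.8 Thm. (3.90) (pp. 61–62)] [cite: Wagner2006, Thm. 5.8(d), §5.3] -/
theorem realEnv3_andFree_nonneg (hF : IsTTSP F a b) (hy : y ∈ F) (hz : z ∈ F) (hw : w ∈ F) (hyz : y ≠ z) (hyw : y ≠ w) (hzw : z ≠ w)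
    (hM : M ⊆ ((F.erase y).erase z).erase w) (hC : C ⊆ ((F.erase y).erase z).erase w) (hMC : Disjoint M C)
    {h0 h1 : ↥M.powerset → ℝ} (m0 : Monotone h0) (m1 : Monotone h1) (le : ∀ β, h0 β ≤ h1 β) (J : ℤ) :
    0 ≤ ∑ β, (h1 β * (realEnv3 M C a b y z w β).gandE1 J + h0 β * (realEnv3 M C a b y z w β).gandE2 J) :=
  realEnv3_andFree_apex none_notMem_range_some hF hy hz hw hyz hyw hzw hM hC hMC m0 m1 le J

end AndFinal

end RootForm

end FK

end Summit.CriticalPhenomena.PercolationContinuityZ3.Theorems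

end
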